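import Summits.Ventures.YMGap.Thresholds.ZeroCouplingWilsonLoopAllGroups
import Mathlib.Analysis.Complex.Exponential
import HarnessLib

/-!
# The exponential Taylor remainder at every order and Gibbs reweightings with vanishing mixed moments
# (tools for the universal strong-coupling perimeter law, row type C-PERIMETER-G, part 2 of 3)

Cell `pub-ymgap`, seat ds-1 (gen 16). HONEST FRAMING: two lemmas of elementary real analysis / probability, behind
`StrongCouplingPerimeterLawAllGroups`; nothing about gauge theories by themselves, nothing about weak coupling, the continuum, or the
Clay problem. Kernel theorems only, 0 definitions, 0 compute.

* `abs_exp_sub_sum_le_pow_mul_exp`: `|e^x − Σ_{k<m} x^k/k!| ≤ |x|^m e^{|x|} / m!` for EVERY real `x` and every order `m` (Mathlib's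
  `Real.exp_bound` needs `|x| ≤ 1`; here the tail `Σ_n x^{n+m}/(n+m)!` is dominated termwise using `m! n! ≤ (n+m)!`).
* ★ `abs_integral_tilted_sub_const_le_pow`: for a probability measure `P`, measurable `|F| ≤ C`, measurable `|H| ≤ B` and a constant
  `c` with `∫ (F − c) H^k dP = 0` for all `k < m`: `|∫ F d(P.tilted(−βH)) − c| ≤ (C + |c|) (|β|B)^m e^{2|β|B} / m!` for EVERY real `β`
  (the reweighted mean minus `c` is `Z⁻¹ ∫ (F − c)(e^{−βH} − T_m(−βH)) dP` with `T_m` the Taylor polynomial and `Z ≥ e^{−|β|B}`).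

References (mechanism): B. Simon, *The Statistical Mechanics of Lattice Gases* I (1993), §II.1 (reweighted expectations).
-/

noncomputable section

open MeasureTheory ProbabilityTheory Set Filter Topology Finset
open scoped NNReal Nat

namespace Summit.Ventures.YMGap.ZeroCouplingSlope

/-! ## 1. The exponential remainder and a Gibbs reweighting whose first `m` mixed moments factorise -/

section Tilted

/-- **Exponential Taylor remainder, every order, every real argument**:
`|e^x − Σ_{k<m} x^k/k!| ≤ |x|^m e^{|x|} / m!` (the tail `Σ_{n} x^{n+m}/(n+m)!` is dominated termwise by
`|x|^m/m! · |x|^n/n!` since `m! n! ≤ (n+m)!`). [folklore] -/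
theorem abs_exp_sub_sum_le_pow_mul_exp (x : ℝ) (m : ℕ) :
    |Real.exp x - ∑ k ∈ Finset.range m, x ^ k / k !| ≤ |x| ^ m * Real.exp |x| / m ! := by
  have hx : HasSum (fun n : ℕ => x ^ n / n !) (Real.exp x) := by
    rw [Real.exp_eq_exp_ℝ]; exact NormedSpace.expSeries_div_hasSum_exp x
  have ha : HasSum (fun n : ℕ => |x| ^ n / n !) (Real.exp |x|) := by
    rw [Real.exp_eq_exp_ℝ]; exact NormedSpace.expSeries_div_hasSum_exp |x|
  have htail : HasSum (fun n : ℕ => x ^ (n + m) / (n + m)!) (Real.exp x - ∑ k ∈ Finset.range m, x ^ k / k !) :=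
    (hasSum_nat_add_iff' m).2 hx
  have hdom : HasSum (fun n : ℕ => |x| ^ m / m ! * (|x| ^ n / n !)) (|x| ^ m / m ! * Real.exp |x|) :=
    ha.mul_left _
  have key := htail.norm_le_of_bounded hdom fun n => by
    rw [Real.norm_eq_abs, abs_div, abs_pow, Nat.abs_cast, pow_add]
    rw [show |x| ^ m / m ! * (|x| ^ n / n !) = |x| ^ n * |x| ^ m / (m ! * n !) by ring]
    have hfac : ((m ! * n ! : ℕ) : ℝ) ≤ ((n + m)! : ℝ) := by
      exact_mod_cast Nat.le_of_dvd (Nat.factorial_pos _) (add_comm m n ▸ Nat.factorial_mul_factorial_dvd_factorial_add m n)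
    push_cast at hfac
    exact div_le_div_of_nonneg_left (by positivity) (by positivity) hfac
  calc _ ≤ |x| ^ m / m ! * Real.exp |x| := by simpa [Real.norm_eq_abs] using key
    _ = |x| ^ m * Real.exp |x| / m ! := by ring

variable {Ω : Type*} {mΩ : MeasurableSpace Ω} {P : Measure Ω} [IsProbabilityMeasure P] {F H : Ω → ℝ} {B C : ℝ}

/-- ★ **A Gibbs reweighting whose first `m` mixed moments factorise is `O(β^m)`-close to the constant.** For a probability
measure `P`, measurable `|F| ≤ C`, measurable `|H| ≤ B` and a constant `c` with `∫ (F − c) H^k dP = 0` for every `k < m`,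
`|∫ F d(P.tilted(−βH)) − c| ≤ (C + |c|) (|β| B)^m e^{2|β|B} / m!` for EVERY real `β`
(`∫ F d(P.tilted(−βH)) − c = ∫ (F − c)(e^{−βH} − T_m(−βH)) dP / Z` with `T_m` the Taylor polynomial, `Z ≥ e^{−|β|B}`, and the
exponential remainder `abs_exp_sub_sum_le_pow_mul_exp`). [folklore] -/
theorem abs_integral_tilted_sub_const_le_pow (hF : Measurable F) (hC : ∀ ω, |F ω| ≤ C) (hH : Measurable H)
    (hB : ∀ ω, |H ω| ≤ B) (c : ℝ) {m : ℕ} (hmom : ∀ k < m, ∫ ω, (F ω - c) * H ω ^ k ∂P = 0) (β : ℝ) :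
    |(∫ ω, F ω ∂(P.tilted fun ω => -β * H ω)) - c| ≤
      (C + |c|) * (|β| * B) ^ m * Real.exp (2 * (|β| * B)) / m ! := by
  obtain ⟨ω₀⟩ := nonempty_of_isProbabilityMeasure P
  have hB0 : 0 ≤ B := (abs_nonneg _).trans (hB ω₀)
  have hC0 : 0 ≤ C := (abs_nonneg _).trans (hC ω₀)
  set w : Ω → ℝ := fun ω => Real.exp (-β * H ω) with hw
  have hβH : ∀ ω, |(-β) * H ω| ≤ |β| * B := fun ω => by
    rw [abs_mul, abs_neg]; exact mul_le_mul_of_nonneg_left (hB ω) (abs_nonneg _)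
  have hw_le : ∀ ω, w ω ≤ Real.exp (|β| * B) := fun ω => Real.exp_le_exp.2 ((le_abs_self _).trans (hβH ω))
  have hw_ge : ∀ ω, Real.exp (-(|β| * B)) ≤ w ω := fun ω => Real.exp_le_exp.2 (by
    have := neg_abs_le (-β * H ω); linarith [hβH ω])
  have hwm : Measurable w := (hH.const_mul _).exp
  have hwi : Integrable w P := Literature.MathematicalPhysics.QuantumLattice.integrable_of_bound hwm.aestronglyMeasurable
    (C := Real.exp (|β| * B)) fun ω => by rw [abs_of_pos (Real.exp_pos _)]; exact hw_le ω
  set Z : ℝ := ∫ ω, w ω ∂P with hZ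
  have hZ_ge : Real.exp (-(|β| * B)) ≤ Z := by
    have h := integral_mono (integrable_const (Real.exp (-(|β| * B)))) hwi hw_ge
    simpa using h
  have hZpos : 0 < Z := (Real.exp_pos _).trans_le hZ_ge
  -- the Taylor polynomial part integrates to zero against `F − c`
  set T : Ω → ℝ := fun ω => ∑ k ∈ Finset.range m, (-β * H ω) ^ k / k ! with hT
  have hFc : ∀ ω, |F ω - c| ≤ C + |c| := fun ω => (abs_sub _ _).trans (add_le_add (hC ω) le_rfl)
  have hbdd : ∀ {g : Ω → ℝ} {K : ℝ}, Measurable g → (∀ ω, |g ω| ≤ K) → Integrable g P := fun hg hK =>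
    Literature.MathematicalPhysics.QuantumLattice.integrable_of_bound hg.aestronglyMeasurable hK
  have hHk : ∀ k : ℕ, Integrable (fun ω => (F ω - c) * H ω ^ k) P := fun k =>
    hbdd ((hF.sub_const c).mul (hH.pow_const k)) (K := (C + |c|) * B ^ k) fun ω => by
      rw [abs_mul, abs_pow]; exact mul_le_mul (hFc ω) (pow_le_pow_left₀ (abs_nonneg _) (hB ω) k) (by positivity)
        (by positivity)
  have hT0 : ∫ ω, (F ω - c) * T ω ∂P = 0 := by
    have e : ∀ ω, (F ω - c) * T ω = ∑ k ∈ Finset.range m, ((-β) ^ k / k !) * ((F ω - c) * H ω ^ k) := fun ω => by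
      simp only [hT, Finset.mul_sum]; exact Finset.sum_congr rfl fun k _ => by rw [mul_pow]; ring
    simp_rw [e]
    rw [integral_finsetSum _ fun k _ => (hHk k).const_mul _]
    exact Finset.sum_eq_zero fun k hk => by rw [integral_const_mul, hmom k (Finset.mem_range.1 hk), mul_zero]
  -- the tilted expectation minus `c` is `Z⁻¹ ∫ (F − c) w`
  have htilt : (∫ ω, F ω ∂(P.tilted fun ω => -β * H ω)) - c = Z⁻¹ * ∫ ω, (F ω - c) * w ω ∂P := by
    rw [integral_tilted]
    have e1 : ∀ ω, (Real.exp (-β * H ω) / ∫ ω, Real.exp (-β * H ω) ∂P) • F ω = Z⁻¹ * (F ω * w ω) := fun ω => by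
      simp only [hZ, hw, smul_eq_mul]; ring
    simp_rw [e1]
    have hi1 : Integrable (fun ω => F ω * w ω) P := hbdd (hF.mul hwm) (K := C * Real.exp (|β| * B)) fun ω => by
      rw [abs_mul, abs_of_pos (Real.exp_pos _)]; exact mul_le_mul (hC ω) (hw_le ω) (Real.exp_pos _).le hC0
    rw [integral_const_mul]
    have e2 : ∀ ω, (F ω - c) * w ω = F ω * w ω - c * w ω := fun ω => by ring
    simp_rw [e2]
    rw [integral_sub hi1 (hwi.const_mul c), integral_const_mul, ← hZ]
    field_simp
  -- remainder estimate
  have hrem : ∀ ω, |w ω - T ω| ≤ (|β| * B) ^ m * Real.exp (|β| * B) / m ! := fun ω => by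
    have h := abs_exp_sub_sum_le_pow_mul_exp (-β * H ω) m
    refine h.trans ?_
    have h1 : |(-β) * H ω| ^ m ≤ (|β| * B) ^ m := pow_le_pow_left₀ (abs_nonneg _) (hβH ω) m
    have h2 : Real.exp |(-β) * H ω| ≤ Real.exp (|β| * B) := Real.exp_le_exp.2 (hβH ω)
    exact div_le_div_of_nonneg_right (mul_le_mul h1 h2 (Real.exp_pos _).le (by positivity)) (by positivity)
  have hTm : Measurable T := Finset.measurable_sum _ fun k _ => ((hH.const_mul _).pow_const k).div_const _
  have hTi : Integrable (fun ω => (F ω - c) * T ω) P := by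
    have e : ∀ ω, (F ω - c) * T ω = ∑ k ∈ Finset.range m, ((-β) ^ k / k !) * ((F ω - c) * H ω ^ k) := fun ω => by
      simp only [hT, Finset.mul_sum]; exact Finset.sum_congr rfl fun k _ => by rw [mul_pow]; ring
    simp_rw [e]; exact integrable_finsetSum _ fun k _ => (hHk k).const_mul _
  have hwFi : Integrable (fun ω => (F ω - c) * w ω) P :=
    hbdd ((hF.sub_const c).mul hwm) (K := (C + |c|) * Real.exp (|β| * B)) fun ω => by
      rw [abs_mul, abs_of_pos (Real.exp_pos _)]; exact mul_le_mul (hFc ω) (hw_le ω) (Real.exp_pos _).le (by positivity)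
  have hnum : |∫ ω, (F ω - c) * w ω ∂P| ≤ (C + |c|) * ((|β| * B) ^ m * Real.exp (|β| * B) / m !) := by
    rw [show (∫ ω, (F ω - c) * w ω ∂P) = ∫ ω, (F ω - c) * (w ω - T ω) ∂P by
      have e : ∀ ω, (F ω - c) * (w ω - T ω) = (F ω - c) * w ω - (F ω - c) * T ω := fun ω => by ring
      simp_rw [e]; rw [integral_sub hwFi hTi, hT0, sub_zero]]
    have h := norm_integral_le_of_norm_le_const (μ := P) (f := fun ω => (F ω - c) * (w ω - T ω))
      (C := (C + |c|) * ((|β| * B) ^ m * Real.exp (|β| * B) / m !)) (ae_of_all _ fun ω => by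
        rw [Real.norm_eq_abs, abs_mul]
        exact mul_le_mul (hFc ω) (hrem ω) (abs_nonneg _) (by positivity))
    rw [probReal_univ, mul_one] at h
    simpa only [Real.norm_eq_abs] using h
  rw [htilt, abs_mul, abs_inv, abs_of_pos hZpos]
  have hZinv : Z⁻¹ ≤ Real.exp (|β| * B) := by
    rw [inv_le_comm₀ hZpos (Real.exp_pos _), ← Real.exp_neg]; exact hZ_ge
  calc Z⁻¹ * |∫ ω, (F ω - c) * w ω ∂P|
      ≤ Real.exp (|β| * B) * ((C + |c|) * ((|β| * B) ^ m * Real.exp (|β| * B) / m !)) :=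
        mul_le_mul hZinv hnum (abs_nonneg _) (Real.exp_pos _).le
    _ = (C + |c|) * (|β| * B) ^ m * Real.exp (2 * (|β| * B)) / m ! := by
        rw [show (2 : ℝ) * (|β| * B) = |β| * B + |β| * B by ring, Real.exp_add]; ring

end Tilted

end Summit.Ventures.YMGap.ZeroCouplingSlope
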